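import Mathlib
import HarnessLib
import Summits.NavierStokesRegularity.NavierStokesRegularity.Theorems.PoloidalWindowDoorPoloidalWindowRigidityLocalVorticitySymmetry
import Summits.NavierStokesRegularity.NavierStokesRegularity.Theorems.PoloidalWindowDoorPoloidalWindowRigidityOneSliceCurlAxisymmetric
import Summits.NavierStokesRegularity.NavierStokesRegularity.Theorems.PoloidalWindowDoorPoloidalWindowRigidityDegenerateSlice

/-!
# K2 `PoloidalWindowRigidity` (stmt-NavierStokesRegularity-19708) — THE ASSEMBLY OF THE PROPOSED LINE «lrc-jet» MODULO LRC′
# (stub L4, with L1 = LRC′ as an EXPLICIT HYPOTHESIS in its local, one-slice, coordinate form)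

Cell ns-regularity-ideate, seat nsreg-p7 gen 7 (third worker under the K2 lead ns-poloidal-K2-p1).  The lead's line
proposal (HOME/ns-poloidal-K2-p1/LINE-PROPOSAL-lrc-jet.md) composes K2 from the conjecture LRC′ («at a point of a
poloidal analytic NS slice where ω ≠ 0 and the Clebsch slope Λ ∉ {0,1}, the VORTICITY has a local one-parameter
horizontal isometry»), the analytic continuation of such a symmetry (L2: ns-poloidal-K2-p3's `…LocalVorticitySymmetry`
for translations, this seat's `…OneSliceCurlAxisymmetric` for rotations about ANY vertical axis), and the Λ-degenerate
bookkeeping (L3: this seat's `…DegenerateSlice`).  This file is the checked composition: it takes LRC′ as a HYPOTHESIS —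
stated in coordinates, on ONE slice, at ONE point, with the conclusion on SOME nonempty open set of that slice — and
proves the conclusion of the crux's residue, `¬ IsBackwardSingularPoint v 0`, for every profile of the route's Type-I
class that is poloidal along `e₃` on every slice.  Nothing is registered here: the statement of L1 is the lead's /
planner's call; this file shows that THE SHAPE BELOW suffices and that L2 + L3 + L4 are kernel-complete.

Hypothesis shape (`hLRC`, for the slice `s`): for every point `y` with `curl v(s)(y) ≠ 0`, `∇_h(v·e₃)(y) ≠ 0`
(`Λ ≠ 0`) and `∂₃v_h(y) ≠ 0` (`Λ ≠ 1`), there is a nonempty open set `U` of the slice on which EITHER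
`D(curl v(s))(z)[e] = 0` for a fixed `e ≠ 0` (translations) OR `J curl v(s)(z) = D(curl v(s))(z)[J(z − c)]` for a fixed
centre `c` (rotations about the vertical axis through `c`).

WHAT THIS IS NOT: not a claim about Navier–Stokes regularity, NOT a proof of LRC′, not the crux — the residue S2⁗
CONDITIONAL on LRC′ (bears_on LADDER-NS N0, route PoloidalWindowDoor, crux K2; `--supports` the K2 item).
-/

noncomputable section

-- the summit and its single sub-problem share the name (CONVENTIONS §1), as in every Theorems file
set_option linter.dupNamespace false

namespace Summit.NavierStokesRegularity.NavierStokesRegularity.Theorems.PoloidalWindowDoorPoloidalWindowRigidityLrcJetAssembly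

open MeasureTheory Set Function Filter Topology Metric InnerProductSpace
open scoped RealInnerProductSpace
open Literature.Analysis Literature.Analysis.FluidPDE
open Summit.NavierStokesRegularity.NavierStokesRegularity.Theorems.PoloidalWindowDoorPoloidalWindowRigidityLocalVorticitySymmetry
open Summit.NavierStokesRegularity.NavierStokesRegularity.Theorems.PoloidalWindowDoorPoloidalWindowRigidityOneSliceCurlAxisymmetric
open Summit.NavierStokesRegularity.NavierStokesRegularity.Theorems.PoloidalWindowDoorPoloidalWindowRigidityDegenerateSlice

variable {C : ℝ} {v : ℝ → EuclideanSpace ℝ (Fin 3) → EuclideanSpace ℝ (Fin 3)}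

/-- **S2⁗ MODULO LRC′ (the assembly of «lrc-jet»).**  Let `v` be a profile of the route's Type-I class, poloidal along
`e₃` on every slice, and let `s < 0` be a slice on which the local conclusion of LRC′ holds in the shape described in
the module docstring (`hLRC`).  Then the apex is not backward-singular.  Case split on the slice: if some point is
generic (`ω ≠ 0`, `Λ ∉ {0,1}`), `hLRC` gives a Killing germ of the vorticity on an open set — translations: K2-p3's
`nonflatLiouville_of_local_curl_translation`; rotations: `nonflatLiouville_of_curl_rotDefect_eq_zero_on_open` — else the
slice is pointwise degenerate and `nonflatLiouville_of_pointwise_degenerate_slice` applies. -/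
theorem nonflatLiouville_of_lrc (hrate : HasTypeITimeDecay C v)
    (hcont : ContinuousOn (uncurry v) (Iio (0 : ℝ) ×ˢ univ))
    (hmild : ∀ s t : ℝ, s < t → t < 0 → ∀ x,
      v t x = UnboundedOperators.heatExtension (v s) (t - s) x - oseenDuhamel 1 s v v t x)
    (hdiv : ∀ t < 0, VectorCalculus.IsDivFree (v t))
    (hpol : ∀ s < 0, ∀ y, ⟪curl (v s) y, EuclideanSpace.single 2 1⟫_ℝ = 0)
    {s : ℝ} (hs : s < 0)
    (hLRC : ∀ y : EuclideanSpace ℝ (Fin 3), curl (v s) y ≠ 0 →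
      ¬ (fderiv ℝ (v s) y (EuclideanSpace.single 0 1) 2 = 0 ∧ fderiv ℝ (v s) y (EuclideanSpace.single 1 1) 2 = 0) →
      ¬ (fderiv ℝ (v s) y (EuclideanSpace.single 2 1) 0 = 0 ∧ fderiv ℝ (v s) y (EuclideanSpace.single 2 1) 1 = 0) →
      ∃ U : Set (EuclideanSpace ℝ (Fin 3)), IsOpen U ∧ U.Nonempty ∧
        ((∃ e : EuclideanSpace ℝ (Fin 3), e ≠ 0 ∧ ∀ z ∈ U, fderiv ℝ (curl (v s)) z e = 0) ∨
         (∃ c : EuclideanSpace ℝ (Fin 3), ∀ z ∈ U, rotGen (curl (v s) z) = fderiv ℝ (curl (v s)) z (rotGen (z - c))))) :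
    ¬ IsBackwardSingularPoint v 0 := by
  by_cases hgen : ∃ y : EuclideanSpace ℝ (Fin 3), curl (v s) y ≠ 0 ∧
      ¬ (fderiv ℝ (v s) y (EuclideanSpace.single 0 1) 2 = 0 ∧ fderiv ℝ (v s) y (EuclideanSpace.single 1 1) 2 = 0) ∧
      ¬ (fderiv ℝ (v s) y (EuclideanSpace.single 2 1) 0 = 0 ∧ fderiv ℝ (v s) y (EuclideanSpace.single 2 1) 1 = 0)
  · -- a generic point: LRC′ gives a Killing germ of the vorticity
    obtain ⟨y, hω, hΛ0, hΛ1⟩ := hgen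
    obtain ⟨U, hU, hne, hsym⟩ := hLRC y hω hΛ0 hΛ1
    rcases hsym with ⟨e, he, htr⟩ | ⟨c, hrot⟩
    · exact nonflatLiouville_of_local_curl_translation hrate hcont hmild hdiv hs he hU hne htr
    · exact nonflatLiouville_of_curl_rotDefect_eq_zero_on_open hrate hcont hmild hdiv hpol c hs hU hne hrot
  · -- no generic point: the slice is pointwise degenerate
    refine nonflatLiouville_of_pointwise_degenerate_slice hrate hcont hmild hdiv hs (hpol s hs) fun y => ?_
    have hy := not_exists.1 hgen y
    by_cases hω : curl (v s) y = 0
    · exact Or.inl hω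
    by_cases h0 : fderiv ℝ (v s) y (EuclideanSpace.single 0 1) 2 = 0 ∧ fderiv ℝ (v s) y (EuclideanSpace.single 1 1) 2 = 0
    · exact Or.inr (Or.inl h0)
    refine Or.inr (Or.inr ?_)
    by_contra h1
    exact hy ⟨hω, h0, h1⟩

/-- **The all-slices packaging**: if the LRC′ shape holds on EVERY slice (as the conjecture is stated: for all times in
the interval), the same conclusion — recorded so that the lead can register L1 with either quantifier. -/
theorem nonflatLiouville_of_lrc_allSlices (hrate : HasTypeITimeDecay C v)
    (hcont : ContinuousOn (uncurry v) (Iio (0 : ℝ) ×ˢ univ))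
    (hmild : ∀ s t : ℝ, s < t → t < 0 → ∀ x,
      v t x = UnboundedOperators.heatExtension (v s) (t - s) x - oseenDuhamel 1 s v v t x)
    (hdiv : ∀ t < 0, VectorCalculus.IsDivFree (v t))
    (hpol : ∀ s < 0, ∀ y, ⟪curl (v s) y, EuclideanSpace.single 2 1⟫_ℝ = 0)
    (hLRC : ∀ s < 0, ∀ y : EuclideanSpace ℝ (Fin 3), curl (v s) y ≠ 0 →
      ¬ (fderiv ℝ (v s) y (EuclideanSpace.single 0 1) 2 = 0 ∧ fderiv ℝ (v s) y (EuclideanSpace.single 1 1) 2 = 0) →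
      ¬ (fderiv ℝ (v s) y (EuclideanSpace.single 2 1) 0 = 0 ∧ fderiv ℝ (v s) y (EuclideanSpace.single 2 1) 1 = 0) →
      ∃ U : Set (EuclideanSpace ℝ (Fin 3)), IsOpen U ∧ U.Nonempty ∧
        ((∃ e : EuclideanSpace ℝ (Fin 3), e ≠ 0 ∧ ∀ z ∈ U, fderiv ℝ (curl (v s)) z e = 0) ∨
         (∃ c : EuclideanSpace ℝ (Fin 3), ∀ z ∈ U, rotGen (curl (v s) z) = fderiv ℝ (curl (v s)) z (rotGen (z - c))))) :
    ¬ IsBackwardSingularPoint v 0 :=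
  nonflatLiouville_of_lrc hrate hcont hmild hdiv hpol (show (-1 : ℝ) < 0 by norm_num) (hLRC (-1) (by norm_num))

end Summit.NavierStokesRegularity.NavierStokesRegularity.Theorems.PoloidalWindowDoorPoloidalWindowRigidityLrcJetAssembly

end
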